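import Literature.NumberTheory.EllipticCurves.KugaSatoVariety
import HarnessLib

/-!
# Functoriality of the fibre powers `E^m = E ×_S ⋯ ×_S E` in the pair `(E → S)`

Topic: `Literature/NumberTheory/EllipticCurves`. Companion to `KugaSatoVariety.lean`
(`KugaSato.fibrePower E m = ∏_{Fin m} E` in `Over S`, with `proj`, `lift`, `hom_ext`, `perm`,
`onFactor`). For a commutative square of schemes
```
E' --G--> E
|         |
S' --g--> S
```
(`w : G ≫ E.hom = E'.hom ≫ g`) this file constructs the induced morphism of `m`-fold fibre powers
`G^m = G ×_g ⋯ ×_g G : E'^m → E^m` over `g` and proves: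

* `KugaSato.liftLeft`, `liftLeft_proj`, `liftLeft_hom`, `KugaSato.left_ext` — the universal
  property of `E^m` for morphisms given on underlying schemes (`T → E^m` over a given `T → S`
  from components `T → E`);
* `KugaSato.mapFibrePower g G w m` with its defining equations `mapFibrePower_proj`
  (`G^m ≫ p_i = p'_i ≫ G`) and `mapFibrePower_hom` (it covers `g`), and uniqueness
  (`mapFibrePower_unique`);
* `KugaSato.isPullback_mapFibrePower`: if the square `(G, g)` is cartesian then so is
  `(G^m, g)`, i.e. `E'^m = S' ×_S E^m` — fibre powers commute with base change (Deligne 1969, §5: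
  the `k`-fold fibre power of the universal curve, formed over `M_n` and base-changed; Deninger–
  Scholl (4.2));
* equivariance: `mapFibrePower_perm` (`G^m` commutes with the permutations of the factors) and
  `mapFibrePower_onFactor` (with `onFactor i f`, for `f`, `f'` intertwined by `G`).

This is the morphism `F` demanded by the field `KugaSatoVariety.sl_extends` (with `S' = S = Y`,
`g = slY γ`, `G` the base change classifying `(E, φ ∘ γ)`), and the identification needed to
restrict `E^m` along a component `Y ↪ Y(N)_K`. Everything here is elementary category theory over
Mathlib's `Over S` and `IsPullback`; no named facts.

## References

* P. Deligne, *Formes modulaires et représentations ℓ-adiques*, Sém. Bourbaki 355 (1969), §5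
  (paragraph before Lemme 5.4). [Deligne1971Bourbaki355]
* C. Deninger, A. J. Scholl, *The Beilinson conjectures*, in *L-functions and Arithmetic*,
  LMS LNS 153 (1991), (4.2). [DeningerScholl1991]
-/

universe u

open CategoryTheory Limits AlgebraicGeometry

noncomputable section

namespace Literature.NumberTheory.EllipticCurves

namespace KugaSato

section LiftLeft

variable {S : Scheme.{u}} (E : Over S) (m : ℕ) {T : Scheme.{u}} (t : T ⟶ S)

/-- The morphism of schemes `T → E^m` with components `f i : T → E`, all lying over the same
`t : T → S` (the universal property of the fibre product `E ×_S ⋯ ×_S E`, for morphisms given on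
underlying schemes: `KugaSato.lift` applied to `T` viewed as an `S`-scheme through `t`).
[folklore] -/
def liftLeft (f : Fin m → (T ⟶ E.left)) (hf : ∀ i, f i ≫ E.hom = t) :
    T ⟶ (fibrePower E m).left :=
  (lift E m (T := Over.mk t) fun i => Over.homMk (f i) (hf i)).left

/-- Components of `liftLeft`: `liftLeft f ≫ p_i = f i`. [folklore] -/
@[reassoc (attr := simp)]
theorem liftLeft_proj (f : Fin m → (T ⟶ E.left)) (hf : ∀ i, f i ≫ E.hom = t) (i : Fin m) :
    liftLeft E m t f hf ≫ (proj E m i).left = f i :=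
  congr_arg CommaMorphism.left (lift_proj E m (T := Over.mk t) (fun i => Over.homMk (f i) (hf i)) i)

/-- `liftLeft f` lies over `t`. [folklore] -/
@[reassoc (attr := simp)]
theorem liftLeft_hom (f : Fin m → (T ⟶ E.left)) (hf : ∀ i, f i ≫ E.hom = t) :
    liftLeft E m t f hf ≫ (fibrePower E m).hom = t :=
  Over.w (lift E m (T := Over.mk t) fun i => Over.homMk (f i) (hf i))

variable {E m t} in
/-- Two morphisms of schemes `T → E^m` lying over the same morphism `t : T → S` agree as soon as
all their components `T → E` agree. [folklore] -/
theorem left_ext {F₁ F₂ : T ⟶ (fibrePower E m).left}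
    (h₁ : F₁ ≫ (fibrePower E m).hom = t) (h₂ : F₂ ≫ (fibrePower E m).hom = t)
    (h : ∀ i, F₁ ≫ (proj E m i).left = F₂ ≫ (proj E m i).left) : F₁ = F₂ := by
  have key : Over.homMk (U := Over.mk t) (V := fibrePower E m) F₁ h₁ =
      Over.homMk (U := Over.mk t) (V := fibrePower E m) F₂ h₂ :=
    hom_ext E m fun i => Over.OverMorphism.ext (h i)
  exact congr_arg CommaMorphism.left key

end LiftLeft

variable {S S' : Scheme.{u}} {E : Over S} {E' : Over S'} (g : S' ⟶ S) (G : E'.left ⟶ E.left)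
  (w : G ≫ E.hom = E'.hom ≫ g)

/-- **The induced morphism of fibre powers** `G^m = G ×_g ⋯ ×_g G : E'^m → E^m` over `g : S' → S`
for a commutative square `G ≫ (E → S) = (E' → S') ≫ g`: the morphism into the fibre product
`E^m` with components `p'_i ≫ G`, over `E'^m → S' → S` (Deligne §5; Deninger–Scholl (4.2): the
fibre powers are functorial in the family). [cite: DeningerScholl1991, (4.2)] -/
def mapFibrePower (m : ℕ) : (fibrePower E' m).left ⟶ (fibrePower E m).left :=
  liftLeft E m ((fibrePower E' m).hom ≫ g) (fun i => (proj E' m i).left ≫ G) fun i => by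
    rw [Category.assoc, w, Over.w_assoc]

/-- The `i`-th component of `G^m` is `p'_i ≫ G`. [folklore] -/
@[reassoc (attr := simp)]
theorem mapFibrePower_proj (m : ℕ) (i : Fin m) :
    mapFibrePower g G w m ≫ (proj E m i).left = (proj E' m i).left ≫ G :=
  liftLeft_proj E m _ _ _ i

/-- `G^m` lies over `g`: `G^m ≫ (E^m → S) = (E'^m → S') ≫ g`. [folklore] -/
@[reassoc (attr := simp)]
theorem mapFibrePower_hom (m : ℕ) :
    mapFibrePower g G w m ≫ (fibrePower E m).hom = (fibrePower E' m).hom ≫ g :=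
  liftLeft_hom E m _ _ _

/-- Uniqueness: a morphism `E'^m → E^m` over `g` whose components are `p'_i ≫ G` is `G^m`.
[folklore] -/
theorem mapFibrePower_unique (m : ℕ) (F : (fibrePower E' m).left ⟶ (fibrePower E m).left)
    (hF : F ≫ (fibrePower E m).hom = (fibrePower E' m).hom ≫ g)
    (hF' : ∀ i, F ≫ (proj E m i).left = (proj E' m i).left ≫ G) :
    F = mapFibrePower g G w m :=
  left_ext hF (mapFibrePower_hom g G w m) fun i => by rw [hF', mapFibrePower_proj]

/-- Along the identity square, `G^m` is the identity. [folklore] -/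
theorem mapFibrePower_id (m : ℕ) :
    mapFibrePower (E := E) (E' := E) (𝟙 S) (𝟙 E.left) (by simp) m = 𝟙 (fibrePower E m).left :=
  (mapFibrePower_unique (E := E) (E' := E) (𝟙 S) (𝟙 E.left) (by simp) m (𝟙 _) (by simp)
    fun i => by simp).symm

/-- **Fibre powers commute with base change**: if `(G, g)` is a cartesian square then so is
`(G^m, g)`, i.e. `E'^m ≅ S' ×_S E^m` via `(G^m, E'^m → S')` (Deligne §5, Deninger–Scholl (4.2):
the fibre power of the base-changed family is the base change of the fibre power). Proof: a cone
`(a : T → E^m, b : T → S')` lifts componentwise through the cartesian squares `(G, g)`.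
[cite: Deligne1971Bourbaki355, §5 (paragraph before Lemme 5.4)] -/
theorem isPullback_mapFibrePower (hG : IsPullback G E'.hom E.hom g) (m : ℕ) :
    IsPullback (mapFibrePower g G hG.w m) (fibrePower E' m).hom (fibrePower E m).hom g := by
  -- the components of the lift of a cone `s = (s.fst : T → E^m, s.snd : T → S')`
  have hc : ∀ (s : PullbackCone (fibrePower E m).hom g) (i : Fin m),
      (s.fst ≫ (proj E m i).left) ≫ E.hom = s.snd ≫ g := fun s i => by
    rw [Category.assoc, Over.w, s.condition]
  let c : ∀ (s : PullbackCone (fibrePower E m).hom g) (i : Fin m), s.pt ⟶ E'.left :=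
    fun s i => hG.lift (s.fst ≫ (proj E m i).left) s.snd (hc s i)
  let l : ∀ s : PullbackCone (fibrePower E m).hom g, s.pt ⟶ (fibrePower E' m).left :=
    fun s => liftLeft E' m s.snd (c s) fun i => hG.lift_snd _ _ _
  refine IsPullback.of_isLimit' ⟨mapFibrePower_hom g G hG.w m⟩
    (PullbackCone.IsLimit.mk _ l (fun s => ?_) (fun s => liftLeft_hom E' m _ _ _)
      (fun s k hk hk' => ?_))
  · refine left_ext (t := s.snd ≫ g) (by rw [Category.assoc, mapFibrePower_hom, liftLeft_hom_assoc])
      s.condition fun i => ?_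
    rw [Category.assoc, mapFibrePower_proj, liftLeft_proj_assoc]
    exact hG.lift_fst _ _ _
  · refine left_ext hk' (liftLeft_hom E' m _ _ _) fun i => ?_
    rw [liftLeft_proj]
    apply hG.hom_ext
    · rw [hG.lift_fst, Category.assoc, ← mapFibrePower_proj g G hG.w m i, ← Category.assoc, hk]
    · rw [hG.lift_snd, Category.assoc, Over.w, hk']

/-- `G^m` commutes with the permutations of the factors. [folklore] -/
theorem mapFibrePower_perm (m : ℕ) (σ : Equiv.Perm (Fin m)) :
    mapFibrePower g G w m ≫ (perm E m σ).left = (perm E' m σ).left ≫ mapFibrePower g G w m := by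
  refine left_ext (t := (fibrePower E' m).hom ≫ g)
    (by rw [Category.assoc, Over.w, mapFibrePower_hom])
    (by rw [Category.assoc, mapFibrePower_hom, Over.w_assoc]) fun i => ?_
  rw [Category.assoc, ← Over.comp_left, perm_proj, mapFibrePower_proj, Category.assoc,
    mapFibrePower_proj, ← Category.assoc, ← Over.comp_left, perm_proj]

/-- `G^m` intertwines `onFactor i f'` and `onFactor i f` for endomorphisms `f'` of `E'` and `f` of
`E` intertwined by `G`. [folklore] -/
theorem mapFibrePower_onFactor (m : ℕ) (i : Fin m) (f : E ⟶ E) (f' : E' ⟶ E')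
    (hf : f'.left ≫ G = G ≫ f.left) :
    mapFibrePower g G w m ≫ (onFactor E m i f).left =
      (onFactor E' m i f').left ≫ mapFibrePower g G w m := by
  refine left_ext (t := (fibrePower E' m).hom ≫ g)
    (by rw [Category.assoc, Over.w, mapFibrePower_hom])
    (by rw [Category.assoc, mapFibrePower_hom, Over.w_assoc]) fun j => ?_
  by_cases h : j = i
  · subst h
    rw [Category.assoc, ← Over.comp_left, onFactor_proj_self, Over.comp_left,
      mapFibrePower_proj_assoc, Category.assoc, mapFibrePower_proj, ← hf]
    simp only [← Category.assoc]
    congr 1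
    rw [← Over.comp_left, ← Over.comp_left, onFactor_proj_self]
  · rw [Category.assoc, ← Over.comp_left, onFactor_proj_of_ne E m h, mapFibrePower_proj,
      Category.assoc, mapFibrePower_proj, ← Category.assoc, ← Over.comp_left,
      onFactor_proj_of_ne E' m h]

end KugaSato

end Literature.NumberTheory.EllipticCurves

end
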